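import Mathlib
import Summits.Ventures.PercRepro2.HCov
import Summits.Ventures.PercRepro2.HCovSwap
import Summits.Ventures.PercRepro2.A3FibreA
import Summits.Ventures.PercRepro2.A3RootEdge
import Summits.Ventures.PercRepro2.A3RootEdgeMain

/-!
# The root-edge closure of (HCOV), part III: both roots, any set of root edges, and the
`_all`-level equivalence `HCov_all ↔ HCovNoRootEdge_all`
(blind cell PercRepro2, p5 g13; `proofs/P5-ROOTEDGE.md` §2 COROLLARY, S4 §2.4 (n) addendum (vii))

* `HCov_of_update_zero_right`: the mirror of `HCov_of_update_zero` at an edge `e = {a₂, a₃}`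
  (the root swap `HCov_swap`);
* `IsRootEdge ends a₁ a₂ a₃ e`: `e` joins `a₃` to `a₁` or to `a₂`; `HCov_of_update_zero_of_isRootEdge`;
* **`HCov_of_zeroOn`**: for a finset `T` of root edges at `a₃`, `HCov (zeroOn p T) → HCov p` — the
  instance with every edge of `T` deleted implies the instance itself (induction on `T` through
  `zeroOn_insert`);
* `NoRootEdge p ends a₁ a₂ a₃`: every root edge at `a₃` has weight `0` (is absent);
  **`HCov_of_noRootEdge_class`**: if (HCOV) holds on the class `NoRootEdge` (same graph, same marks),
  it holds at `p` (delete every root edge at `a₃`);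
* **`HCovNoRootEdge_all R`** (the binders of `HCov_all` plus `NoRootEdge`) and
  **`HCov_all_iff_noRootEdge_all : HCov_all R ↔ HCovNoRootEdge_all R`** — the crux `HCov_all` is
  EQUIVALENT to (HCOV) on the graphs in which `a₃` has no edge to a root.
-/

namespace Summit.Ventures.PercRepro2

open UnionCluster

namespace CovForm

namespace RootEdge

open A3Fibre

section Both

variable {V : Type*} {E : Type*} [Fintype V] [DecidableEq V] [Fintype E] [DecidableEq E]
  {R : Type*} [Field R] [LinearOrder R] [IsStrictOrderedRing R]

/-- The root-edge closure at an edge `e = {a₂, a₃}` (the root swap of `HCov_of_update_zero`). -/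
theorem HCov_of_update_zero_right (p : E → R) (hp : IsProbVec p) (ends : E → Sym2 V)
    (o a₁ a₂ a₃ b : V) (e : E) (hends : ends e = s(a₂, a₃))
    (h₀ : HCov (Function.update p e 0) ends o a₁ a₂ a₃ b) : HCov p ends o a₁ a₂ a₃ b :=
  (HCov_swap p ends o a₁ a₂ a₃ b).1
    (HCov_of_update_zero p hp ends o a₂ a₁ a₃ b e hends
      ((HCov_swap (Function.update p e 0) ends o a₁ a₂ a₃ b).2 h₀))

/-- `e` is a ROOT EDGE AT `a₃`: it joins `a₃` to `a₁` or to `a₂` (either orientation). -/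
def IsRootEdge (ends : E → Sym2 V) (a₁ a₂ a₃ : V) (e : E) : Prop :=
  ends e = s(a₁, a₃) ∨ ends e = s(a₃, a₁) ∨ ends e = s(a₂, a₃) ∨ ends e = s(a₃, a₂)

/-- The root-edge closure at any root edge at `a₃`. -/
theorem HCov_of_update_zero_of_isRootEdge (p : E → R) (hp : IsProbVec p) (ends : E → Sym2 V)
    (o a₁ a₂ a₃ b : V) (e : E) (he : IsRootEdge ends a₁ a₂ a₃ e)
    (h₀ : HCov (Function.update p e 0) ends o a₁ a₂ a₃ b) : HCov p ends o a₁ a₂ a₃ b := by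
  rcases he with h | h | h | h
  · exact HCov_of_update_zero p hp ends o a₁ a₂ a₃ b e h h₀
  · exact HCov_of_update_zero p hp ends o a₁ a₂ a₃ b e (by rw [h, Sym2.eq_swap]) h₀
  · exact HCov_of_update_zero_right p hp ends o a₁ a₂ a₃ b e h h₀
  · exact HCov_of_update_zero_right p hp ends o a₁ a₂ a₃ b e (by rw [h, Sym2.eq_swap]) h₀

/-- **Deleting any set of root edges at `a₃`**: `HCov (zeroOn p T) → HCov p` for every finset `T` of
root edges at `a₃` (induction on `T`; `zeroOn_insert`). -/
theorem HCov_of_zeroOn (p : E → R) (hp : IsProbVec p) (ends : E → Sym2 V) (o a₁ a₂ a₃ b : V)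
    (T : Finset E) (hT : ∀ e ∈ T, IsRootEdge ends a₁ a₂ a₃ e)
    (h₀ : HCov (zeroOn p T) ends o a₁ a₂ a₃ b) : HCov p ends o a₁ a₂ a₃ b := by
  induction T using Finset.induction_on with
  | empty => simpa only [zeroOn_empty] using h₀
  | insert e T _ ih =>
    refine ih (fun e' he' => hT e' (Finset.mem_insert_of_mem he')) ?_
    rw [zeroOn_insert] at h₀
    exact HCov_of_update_zero_of_isRootEdge (zeroOn p T) (isProbVec_zeroOn hp T) ends o a₁ a₂ a₃ b
      e (hT e (Finset.mem_insert_self e T)) h₀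

/-- `a₃` HAS NO ROOT EDGE: every root edge at `a₃` has weight `0` (is absent). -/
def NoRootEdge (p : E → R) (ends : E → Sym2 V) (a₁ a₂ a₃ : V) : Prop :=
  ∀ e, IsRootEdge ends a₁ a₂ a₃ e → p e = 0

omit [Fintype V] [DecidableEq V] [LinearOrder R] [IsStrictOrderedRing R] in
/-- The instance with every root edge at `a₃` deleted has no root edge. -/
lemma noRootEdge_zeroOn_filter (p : E → R) (ends : E → Sym2 V) (a₁ a₂ a₃ : V)
    [DecidablePred (IsRootEdge ends a₁ a₂ a₃)] :
    NoRootEdge (zeroOn p (Finset.univ.filter (IsRootEdge ends a₁ a₂ a₃))) ends a₁ a₂ a₃ := by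
  intro e he
  simp only [zeroOn, Finset.mem_filter, Finset.mem_univ, true_and, he, if_true]

/-- **(HCOV) from the class `NoRootEdge`**: if (HCOV) holds for every admissible weight vector on the
same graph and marks in which `a₃` has no root edge, it holds at `p`. -/
theorem HCov_of_noRootEdge_class (p : E → R) (hp : IsProbVec p) (ends : E → Sym2 V)
    (o a₁ a₂ a₃ b : V)
    (h : ∀ p' : E → R, IsProbVec p' → NoRootEdge p' ends a₁ a₂ a₃ → HCov p' ends o a₁ a₂ a₃ b) :
    HCov p ends o a₁ a₂ a₃ b := by
  classical
  refine HCov_of_zeroOn p hp ends o a₁ a₂ a₃ b (Finset.univ.filter (IsRootEdge ends a₁ a₂ a₃))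
    (fun e he => (Finset.mem_filter.1 he).2) ?_
  exact h _ (isProbVec_zeroOn hp _) (noRootEdge_zeroOn_filter p ends a₁ a₂ a₃)

end Both

section Closure

variable (R : Type*) [Field R] [LinearOrder R] [IsStrictOrderedRing R]

/-- **(HCOV) on every finite graph in which `a₃` has no root edge** (the binders of `HCov_all` plus
`NoRootEdge`). -/
def HCovNoRootEdge_all : Prop :=
  ∀ (V E : Type) [Fintype V] [DecidableEq V] [Fintype E] [DecidableEq E]
    (ends : E → Sym2 V) (p : E → R), IsProbVec p →
    ∀ o a₁ a₂ a₃ b : V, a₁ ≠ a₂ → a₁ ≠ a₃ → a₂ ≠ a₃ → o ≠ a₁ → o ≠ a₂ → o ≠ a₃ → o ≠ b →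
      b ≠ a₁ → b ≠ a₂ → b ≠ a₃ → NoRootEdge p ends a₁ a₂ a₃ → HCov p ends o a₁ a₂ a₃ b

/-- **The crux is equivalent to its restriction to graphs in which `a₃` has no root edge**:
`HCov_all R ↔ HCovNoRootEdge_all R`. -/
theorem HCov_all_iff_noRootEdge_all : HCov_all R ↔ HCovNoRootEdge_all R := by
  constructor
  · intro h V E _ _ _ _ ends p hp o a₁ a₂ a₃ b h1 h2 h3 h4 h5 h6 h7 h8 h9 h10 _
    exact h V E ends p hp o a₁ a₂ a₃ b h1 h2 h3 h4 h5 h6 h7 h8 h9 h10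
  · intro h V E _ _ _ _ ends p hp o a₁ a₂ a₃ b h1 h2 h3 h4 h5 h6 h7 h8 h9 h10
    exact HCov_of_noRootEdge_class p hp ends o a₁ a₂ a₃ b fun p' hp' hn =>
      h V E ends p' hp' o a₁ a₂ a₃ b h1 h2 h3 h4 h5 h6 h7 h8 h9 h10 hn

end Closure

end RootEdge

end CovForm

end Summit.Ventures.PercRepro2
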